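/-
Copyright: the b2b-balaban T⁴-continuum CRUX team, row NE7b OWNER lineage `t4-ne7b-p1` (gen 146). Project licence.
-/
import Mathlib.Analysis.SpecialFunctions.Pow.Real
import Mathlib.Tactic.Positivity
import Mathlib.Tactic.Linarith
import Mathlib.Tactic.Ring

/-!
# THE SIXTEEN-TREE KERNEL UNDER A FULL-GRAPH PRODUCT (SCOPING-d17 §F, F11: the decay half of the supported-tree interpolation; the
# device that makes the order-5 weighted slot sums of the tree terms uniform).  (522)∕(604)∕(609) bound the fourth cumulants inside the
# order-5 display by `C4·T16(r⁻²)`, `T16 = Σ_{16 spanning trees T of 4 sites} Π_{e∈T} r_e⁻²` (`r ≥ 1` the class's tree-decay weight), and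
# (660) routed the full-graph weight onto each of the sixteen trees separately.  THIS FILE replaces the tree sum ONCE AND FOR ALL by a
# FULL-GRAPH product of a slower kernel: for `r₁ ≥ 1` symmetric and submultiplicative with `r₁⁴ ≤ r`,
#   `T16(r⁻²)(a;b,c,d) ≤ 16 · (Π_{6 pairs p ⊂ {a,b,c,d}} r₁(p)⁻¹)²`
# (each pair is carried along its tree path: `Π_{pairs} r₁ ≤ Π_{e∈T} r₁(e)^{load(e)} ≤ Π_{e∈T} r₁(e)⁴ ≤ Π_{e∈T} r(e)`, loads `3,3,3` (star) ∕
        `3,4,3`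
# (path)), whence `√(K·T16) ≤ √(16K)·Π_{pairs} r₁⁻¹`: the interpolated tree entries of `M₅′` decay as a PRODUCT OVER ALL PAIRS, and their
# weighted slot sums factor site by site (exponential instance: `r = e^{ζd}`, `r₁ = e^{ζd∕4}`) (row NE7b, node U5c; Mathlib only; [folklore]).

Cell `pub-balaban`, sub-cell `t4`, spine estimate NE7b (`T4WeightBudget.RelWeightBound`; the cell's OWN estimate — NOT PRINTED in
[Bałaban 1983–89], NOT PROVED).  Crux-route work under `Spine/NE7b/` by the row OWNER (`t4-ne7b-p1` gen 146, file (679)) under FREEZE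
(0)'s crux-prover clause; NOTHING of Bałaban's is named as a Lean object, valued or asserted; no `T4Continuum/Support` leaf typed; no
`def`, no notation (`T16` WRITTEN OUT as printed by (610)); zero `sorry`.  Imports: Mathlib only (fast lane).

WHAT IS PROVED ([folklore]): `monomial_le`, `pow_mono3`, **`tree16_le_fullgraph`**, **`sqrt_mul_tree16_le`**; toy.

HONEST (what this is NOT).  Finite algebra of sixteen monomials; the rate cost (`r₁⁴ ≤ r`: a quarter of the tree rate per pair) is booked,
not optimised; the interpolated tree entries and `M₅′` are the next files; scalar skeleton ((A3), NC-NE7b-α UNRULED); nothing of Bałaban's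
asserted.  BY-NAME EFFECT ON THE WALL: NONE.  NE7b NOT PRINTED ∕ NOT PROVED; spine PROVED 0∕9; rung (B)+1 — the programme's measures remain
FINITE-torus statements; NOT the mass gap, NOT Clay.  HONEST DEPENDENCY: continuum YM on T⁴ ⇐ BetaPertH ∧ nine spine estimates (0∕9 proved);
BetaPertH ⇐ (D1) ∧ (D4) ∧ CAP+tail; G-an2-4 gates asym, D1 and NE2∕3∕4.
-/

set_option autoImplicit false

namespace Summit.QuantumFields.BalabanUV.T4Continuum.NE7b.SupTreeSixteenFullGraph

/-! ## §1. Two scalar lemmas -/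

/-- A tree monomial against the routed product: `0 < P ≤ E₁E₂E₃` and `P⁻¹ = Q` give `(E₁²)⁻¹(E₂²)⁻¹(E₃²)⁻¹ ≤ Q²`. [folklore] -/
theorem monomial_le {E₁ E₂ E₃ P Q : ℝ} (hP : 0 < P) (hPE : P ≤ E₁ * E₂ * E₃) (hQ : P⁻¹ = Q) :
    (E₁ ^ 2)⁻¹ * (E₂ ^ 2)⁻¹ * (E₃ ^ 2)⁻¹ ≤ Q ^ 2 := by
  rw [← hQ, inv_pow]
  have hE : 0 < E₁ * E₂ * E₃ := hP.trans_le hPE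
  calc (E₁ ^ 2)⁻¹ * (E₂ ^ 2)⁻¹ * (E₃ ^ 2)⁻¹ = ((E₁ * E₂ * E₃) ^ 2)⁻¹ := by rw [mul_pow, mul_pow, mul_inv, mul_inv]
    _ ≤ (P ^ 2)⁻¹ := inv_anti₀ (pow_pos hP 2) (pow_le_pow_left₀ hP.le hPE 2)

/-- Powers `≤ 4` of numbers `≥ 1` are dominated by the fourth powers. [folklore] -/
theorem pow_mono3 {a b c : ℝ} (ha : 1 ≤ a) (hb : 1 ≤ b) (hc : 1 ≤ c) {i j k : ℕ} (hi : i ≤ 4) (hj : j ≤ 4) (hk : k ≤ 4) :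
    a ^ i * b ^ j * c ^ k ≤ a ^ 4 * b ^ 4 * c ^ 4 :=
  mul_le_mul (mul_le_mul (pow_le_pow_right₀ ha hi) (pow_le_pow_right₀ hb hj) (by positivity) (by positivity))
    (pow_le_pow_right₀ hc hk) (by positivity) (by positivity)

/-! ## §2. THE END: the sixteen trees under the full-graph product -/

variable {ι : Type} {r r₁ : ι → ι → ℝ}

set_option maxHeartbeats 800000 in
/-- **THE SIXTEEN-TREE KERNEL IS DOMINATED BY THE FULL-GRAPH PRODUCT OF A SLOWER KERNEL**: for `r ≥ 1` and `r₁ ≥ 1` symmetric,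
submultiplicative with `r₁⁴ ≤ r`, `T16(r⁻²)(a;b,c,d) ≤ 16·(Π_{6 pairs} r₁⁻¹)²` — every spanning tree carries every pair of the four sites
along its path (loads `≤ 4`). [folklore] -/
theorem tree16_le_fullgraph (hr1 : ∀ x y, 1 ≤ r x y) (h1 : ∀ x y, 1 ≤ r₁ x y) (hsymm : ∀ x y, r₁ x y = r₁ y x)
    (hmul : ∀ x y z, r₁ x z ≤ r₁ x y * r₁ y z) (h4 : ∀ x y, r₁ x y ^ 4 ≤ r x y) (a b c d : ι) :
    ((r a b ^ 2)⁻¹ * (r a c ^ 2)⁻¹ * (r a d ^ 2)⁻¹ + (r a b ^ 2)⁻¹ * (r b c ^ 2)⁻¹ * (r b d ^ 2)⁻¹ + (r a c ^ 2)⁻¹ * (r b c ^ 2)⁻¹ * (r c d ^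
        2)⁻¹ + (r a d ^ 2)⁻¹ * (r b d ^ 2)⁻¹ * (r c d ^ 2)⁻¹ + (r a b ^ 2)⁻¹ * (r b c ^ 2)⁻¹ * (r c d ^ 2)⁻¹ + (r a b ^ 2)⁻¹ * (r b d ^ 2)⁻¹ * (r
        c d ^ 2)⁻¹ + (r a c ^ 2)⁻¹ * (r b c ^ 2)⁻¹ * (r b d ^ 2)⁻¹ + (r a c ^ 2)⁻¹ * (r b d ^ 2)⁻¹ * (r c d ^ 2)⁻¹ + (r a d ^ 2)⁻¹ * (r b c ^
        2)⁻¹ * (r b d ^ 2)⁻¹ + (r a d ^ 2)⁻¹ * (r b c ^ 2)⁻¹ * (r c d ^ 2)⁻¹ + (r a b ^ 2)⁻¹ * (r a c ^ 2)⁻¹ * (r c d ^ 2)⁻¹ + (r a b ^ 2)⁻¹ * (r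
        a d ^ 2)⁻¹ * (r c d ^ 2)⁻¹ + (r a b ^ 2)⁻¹ * (r a c ^ 2)⁻¹ * (r b d ^ 2)⁻¹ + (r a c ^ 2)⁻¹ * (r a d ^ 2)⁻¹ * (r b d ^ 2)⁻¹ + (r a b ^
        2)⁻¹ * (r a d ^ 2)⁻¹ * (r b c ^ 2)⁻¹ + (r a c ^ 2)⁻¹ * (r a d ^ 2)⁻¹ * (r b c ^ 2)⁻¹) ≤
      16 * ((r₁ a b)⁻¹ * (r₁ a c)⁻¹ * (r₁ a d)⁻¹ * (r₁ b c)⁻¹ * (r₁ b d)⁻¹ * (r₁ c d)⁻¹) ^ 2 := by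
  have h0 : ∀ a b, 0 ≤ r₁ a b := fun a b => zero_le_one.trans (h1 a b)
  have h0' : ∀ a b, 0 ≤ r a b := fun a b => zero_le_one.trans (hr1 a b)
  have hpos : ∀ a b, 0 < r₁ a b := fun a b => lt_of_lt_of_le one_pos (h1 a b)
  have hP : 0 < r₁ a b * r₁ a c * r₁ a d * r₁ b c * r₁ b d * r₁ c d := mul_pos (mul_pos (mul_pos (mul_pos (mul_pos (hpos _ _) (hpos _ _)) (hpos _
        _)) (hpos _ _)) (hpos _ _)) (hpos _ _)
  have hQ : (r₁ a b * r₁ a c * r₁ a d * r₁ b c * r₁ b d * r₁ c d)⁻¹ = (r₁ a b)⁻¹ * (r₁ a c)⁻¹ * (r₁ a d)⁻¹ * (r₁ b c)⁻¹ * (r₁ b d)⁻¹ * (r₁ c d)⁻¹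
        := by simp only [mul_inv]
  have hm00 : ∀ a c b, r₁ a b ≤ r₁ a c * r₁ c b := fun a c b => hmul a c b
  have hm10 : ∀ a c b, r₁ a b ≤ r₁ c a * r₁ c b := fun a c b => by rw [hsymm c a]; exact hmul a c b
  have hm01 : ∀ a c b, r₁ a b ≤ r₁ a c * r₁ b c := fun a c b => by rw [hsymm b c]; exact hmul a c b
  have t0 : ((r a b ^ 2)⁻¹ * (r a c ^ 2)⁻¹ * (r a d ^ 2)⁻¹) ≤ ((r₁ a b)⁻¹ * (r₁ a c)⁻¹ * (r₁ a d)⁻¹ * (r₁ b c)⁻¹ * (r₁ b d)⁻¹ * (r₁ c d)⁻¹) ^ 2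
        := by
    refine monomial_le hP ?_ hQ
    have hR : r₁ a b * r₁ a c * r₁ a d * r₁ b c * r₁ b d * r₁ c d ≤ r₁ a b ^ 4 * r₁ a c ^ 4 * r₁ a d ^ 4 :=
      calc r₁ a b * r₁ a c * r₁ a d * r₁ b c * r₁ b d * r₁ c d = (r₁ a b * r₁ a c * r₁ a d) * (r₁ b c * r₁ b d * r₁ c d) := by ring
        _ ≤ (r₁ a b * r₁ a c * r₁ a d) * ((r₁ a b * r₁ a c) * (r₁ a b * r₁ a d) * (r₁ a c * r₁ a d)) :=
            mul_le_mul_of_nonneg_left (mul_le_mul (mul_le_mul (hm10 b a c) (hm10 b a d) (h0 _ _) (mul_nonneg (h0 _ _) (h0 _ _))) (hm10 c a d) (h0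
        _ _) (mul_nonneg (mul_nonneg (h0 _ _) (h0 _ _)) (mul_nonneg (h0 _ _) (h0 _ _)))) (mul_nonneg (mul_nonneg (h0 _ _) (h0 _ _)) (h0 _ _))
        _ = r₁ a b ^ 3 * r₁ a c ^ 3 * r₁ a d ^ 3 := by ring
        _ ≤ r₁ a b ^ 4 * r₁ a c ^ 4 * r₁ a d ^ 4 := pow_mono3 (h1 _ _) (h1 _ _) (h1 _ _) (by norm_num) (by norm_num) (by norm_num)
    exact hR.trans (mul_le_mul (mul_le_mul (h4 _ _) (h4 _ _) (pow_nonneg (h0 _ _) 4) (h0' _ _)) (h4 _ _) (pow_nonneg (h0 _ _) 4) (mul_nonneg (h0'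
        _ _) (h0' _ _)))
  have t1 : ((r a b ^ 2)⁻¹ * (r b c ^ 2)⁻¹ * (r b d ^ 2)⁻¹) ≤ ((r₁ a b)⁻¹ * (r₁ a c)⁻¹ * (r₁ a d)⁻¹ * (r₁ b c)⁻¹ * (r₁ b d)⁻¹ * (r₁ c d)⁻¹) ^ 2
        := by
    refine monomial_le hP ?_ hQ
    have hR : r₁ a b * r₁ a c * r₁ a d * r₁ b c * r₁ b d * r₁ c d ≤ r₁ a b ^ 4 * r₁ b c ^ 4 * r₁ b d ^ 4 :=
      calc r₁ a b * r₁ a c * r₁ a d * r₁ b c * r₁ b d * r₁ c d = (r₁ a b * r₁ b c * r₁ b d) * (r₁ a c * r₁ a d * r₁ c d) := by ring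
        _ ≤ (r₁ a b * r₁ b c * r₁ b d) * ((r₁ a b * r₁ b c) * (r₁ a b * r₁ b d) * (r₁ b c * r₁ b d)) :=
            mul_le_mul_of_nonneg_left (mul_le_mul (mul_le_mul (hm00 a b c) (hm00 a b d) (h0 _ _) (mul_nonneg (h0 _ _) (h0 _ _))) (hm10 c b d) (h0
        _ _) (mul_nonneg (mul_nonneg (h0 _ _) (h0 _ _)) (mul_nonneg (h0 _ _) (h0 _ _)))) (mul_nonneg (mul_nonneg (h0 _ _) (h0 _ _)) (h0 _ _))
        _ = r₁ a b ^ 3 * r₁ b c ^ 3 * r₁ b d ^ 3 := by ring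
        _ ≤ r₁ a b ^ 4 * r₁ b c ^ 4 * r₁ b d ^ 4 := pow_mono3 (h1 _ _) (h1 _ _) (h1 _ _) (by norm_num) (by norm_num) (by norm_num)
    exact hR.trans (mul_le_mul (mul_le_mul (h4 _ _) (h4 _ _) (pow_nonneg (h0 _ _) 4) (h0' _ _)) (h4 _ _) (pow_nonneg (h0 _ _) 4) (mul_nonneg (h0'
        _ _) (h0' _ _)))
  have t2 : ((r a c ^ 2)⁻¹ * (r b c ^ 2)⁻¹ * (r c d ^ 2)⁻¹) ≤ ((r₁ a b)⁻¹ * (r₁ a c)⁻¹ * (r₁ a d)⁻¹ * (r₁ b c)⁻¹ * (r₁ b d)⁻¹ * (r₁ c d)⁻¹) ^ 2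
        := by
    refine monomial_le hP ?_ hQ
    have hR : r₁ a b * r₁ a c * r₁ a d * r₁ b c * r₁ b d * r₁ c d ≤ r₁ a c ^ 4 * r₁ b c ^ 4 * r₁ c d ^ 4 :=
      calc r₁ a b * r₁ a c * r₁ a d * r₁ b c * r₁ b d * r₁ c d = (r₁ a c * r₁ b c * r₁ c d) * (r₁ a b * r₁ a d * r₁ b d) := by ring
        _ ≤ (r₁ a c * r₁ b c * r₁ c d) * ((r₁ a c * r₁ b c) * (r₁ a c * r₁ c d) * (r₁ b c * r₁ c d)) :=
            mul_le_mul_of_nonneg_left (mul_le_mul (mul_le_mul (hm01 a c b) (hm00 a c d) (h0 _ _) (mul_nonneg (h0 _ _) (h0 _ _))) (hm00 b c d) (h0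
        _ _) (mul_nonneg (mul_nonneg (h0 _ _) (h0 _ _)) (mul_nonneg (h0 _ _) (h0 _ _)))) (mul_nonneg (mul_nonneg (h0 _ _) (h0 _ _)) (h0 _ _))
        _ = r₁ a c ^ 3 * r₁ b c ^ 3 * r₁ c d ^ 3 := by ring
        _ ≤ r₁ a c ^ 4 * r₁ b c ^ 4 * r₁ c d ^ 4 := pow_mono3 (h1 _ _) (h1 _ _) (h1 _ _) (by norm_num) (by norm_num) (by norm_num)
    exact hR.trans (mul_le_mul (mul_le_mul (h4 _ _) (h4 _ _) (pow_nonneg (h0 _ _) 4) (h0' _ _)) (h4 _ _) (pow_nonneg (h0 _ _) 4) (mul_nonneg (h0'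
        _ _) (h0' _ _)))
  have t3 : ((r a d ^ 2)⁻¹ * (r b d ^ 2)⁻¹ * (r c d ^ 2)⁻¹) ≤ ((r₁ a b)⁻¹ * (r₁ a c)⁻¹ * (r₁ a d)⁻¹ * (r₁ b c)⁻¹ * (r₁ b d)⁻¹ * (r₁ c d)⁻¹) ^ 2
        := by
    refine monomial_le hP ?_ hQ
    have hR : r₁ a b * r₁ a c * r₁ a d * r₁ b c * r₁ b d * r₁ c d ≤ r₁ a d ^ 4 * r₁ b d ^ 4 * r₁ c d ^ 4 :=
      calc r₁ a b * r₁ a c * r₁ a d * r₁ b c * r₁ b d * r₁ c d = (r₁ a d * r₁ b d * r₁ c d) * (r₁ a b * r₁ a c * r₁ b c) := by ring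
        _ ≤ (r₁ a d * r₁ b d * r₁ c d) * ((r₁ a d * r₁ b d) * (r₁ a d * r₁ c d) * (r₁ b d * r₁ c d)) :=
            mul_le_mul_of_nonneg_left (mul_le_mul (mul_le_mul (hm01 a d b) (hm01 a d c) (h0 _ _) (mul_nonneg (h0 _ _) (h0 _ _))) (hm01 b d c) (h0
        _ _) (mul_nonneg (mul_nonneg (h0 _ _) (h0 _ _)) (mul_nonneg (h0 _ _) (h0 _ _)))) (mul_nonneg (mul_nonneg (h0 _ _) (h0 _ _)) (h0 _ _))
        _ = r₁ a d ^ 3 * r₁ b d ^ 3 * r₁ c d ^ 3 := by ring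
        _ ≤ r₁ a d ^ 4 * r₁ b d ^ 4 * r₁ c d ^ 4 := pow_mono3 (h1 _ _) (h1 _ _) (h1 _ _) (by norm_num) (by norm_num) (by norm_num)
    exact hR.trans (mul_le_mul (mul_le_mul (h4 _ _) (h4 _ _) (pow_nonneg (h0 _ _) 4) (h0' _ _)) (h4 _ _) (pow_nonneg (h0 _ _) 4) (mul_nonneg (h0'
        _ _) (h0' _ _)))
  have t4 : ((r a b ^ 2)⁻¹ * (r b c ^ 2)⁻¹ * (r c d ^ 2)⁻¹) ≤ ((r₁ a b)⁻¹ * (r₁ a c)⁻¹ * (r₁ a d)⁻¹ * (r₁ b c)⁻¹ * (r₁ b d)⁻¹ * (r₁ c d)⁻¹) ^ 2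
        := by
    refine monomial_le hP ?_ hQ
    have hR : r₁ a b * r₁ a c * r₁ a d * r₁ b c * r₁ b d * r₁ c d ≤ r₁ a b ^ 4 * r₁ b c ^ 4 * r₁ c d ^ 4 :=
      calc r₁ a b * r₁ a c * r₁ a d * r₁ b c * r₁ b d * r₁ c d = (r₁ a b * r₁ b c * r₁ c d) * (r₁ a c * r₁ a d * r₁ b d) := by ring
        _ ≤ (r₁ a b * r₁ b c * r₁ c d) * ((r₁ a b * r₁ b c) * (r₁ a b * (r₁ b c * r₁ c d)) * (r₁ b c * r₁ c d)) :=
            mul_le_mul_of_nonneg_left (mul_le_mul (mul_le_mul (hm00 a b c) ((hm00 a b d).trans (mul_le_mul_of_nonneg_left (hm00 b c d) (h0 _ _)))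
        (h0 _ _) (mul_nonneg (h0 _ _) (h0 _ _))) (hm00 b c d) (h0 _ _) (mul_nonneg (mul_nonneg (h0 _ _) (h0 _ _)) (mul_nonneg (h0 _ _)
        (mul_nonneg (h0 _ _) (h0 _ _))))) (mul_nonneg (mul_nonneg (h0 _ _) (h0 _ _)) (h0 _ _))
        _ = r₁ a b ^ 3 * r₁ b c ^ 4 * r₁ c d ^ 3 := by ring
        _ ≤ r₁ a b ^ 4 * r₁ b c ^ 4 * r₁ c d ^ 4 := pow_mono3 (h1 _ _) (h1 _ _) (h1 _ _) (by norm_num) (by norm_num) (by norm_num)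
    exact hR.trans (mul_le_mul (mul_le_mul (h4 _ _) (h4 _ _) (pow_nonneg (h0 _ _) 4) (h0' _ _)) (h4 _ _) (pow_nonneg (h0 _ _) 4) (mul_nonneg (h0'
        _ _) (h0' _ _)))
  have t5 : ((r a b ^ 2)⁻¹ * (r b d ^ 2)⁻¹ * (r c d ^ 2)⁻¹) ≤ ((r₁ a b)⁻¹ * (r₁ a c)⁻¹ * (r₁ a d)⁻¹ * (r₁ b c)⁻¹ * (r₁ b d)⁻¹ * (r₁ c d)⁻¹) ^ 2
        := by
    refine monomial_le hP ?_ hQ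
    have hR : r₁ a b * r₁ a c * r₁ a d * r₁ b c * r₁ b d * r₁ c d ≤ r₁ a b ^ 4 * r₁ b d ^ 4 * r₁ c d ^ 4 :=
      calc r₁ a b * r₁ a c * r₁ a d * r₁ b c * r₁ b d * r₁ c d = (r₁ a b * r₁ b d * r₁ c d) * (r₁ a c * r₁ a d * r₁ b c) := by ring
        _ ≤ (r₁ a b * r₁ b d * r₁ c d) * ((r₁ a b * (r₁ b d * r₁ c d)) * (r₁ a b * r₁ b d) * (r₁ b d * r₁ c d)) :=
            mul_le_mul_of_nonneg_left (mul_le_mul (mul_le_mul ((hm00 a b c).trans (mul_le_mul_of_nonneg_left (hm01 b d c) (h0 _ _))) (hm00 a b d)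
        (h0 _ _) (mul_nonneg (h0 _ _) (mul_nonneg (h0 _ _) (h0 _ _)))) (hm01 b d c) (h0 _ _) (mul_nonneg (mul_nonneg (h0 _ _) (mul_nonneg (h0 _
        _) (h0 _ _))) (mul_nonneg (h0 _ _) (h0 _ _)))) (mul_nonneg (mul_nonneg (h0 _ _) (h0 _ _)) (h0 _ _))
        _ = r₁ a b ^ 3 * r₁ b d ^ 4 * r₁ c d ^ 3 := by ring
        _ ≤ r₁ a b ^ 4 * r₁ b d ^ 4 * r₁ c d ^ 4 := pow_mono3 (h1 _ _) (h1 _ _) (h1 _ _) (by norm_num) (by norm_num) (by norm_num)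
    exact hR.trans (mul_le_mul (mul_le_mul (h4 _ _) (h4 _ _) (pow_nonneg (h0 _ _) 4) (h0' _ _)) (h4 _ _) (pow_nonneg (h0 _ _) 4) (mul_nonneg (h0'
        _ _) (h0' _ _)))
  have t6 : ((r a c ^ 2)⁻¹ * (r b c ^ 2)⁻¹ * (r b d ^ 2)⁻¹) ≤ ((r₁ a b)⁻¹ * (r₁ a c)⁻¹ * (r₁ a d)⁻¹ * (r₁ b c)⁻¹ * (r₁ b d)⁻¹ * (r₁ c d)⁻¹) ^ 2
        := by
    refine monomial_le hP ?_ hQ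
    have hR : r₁ a b * r₁ a c * r₁ a d * r₁ b c * r₁ b d * r₁ c d ≤ r₁ a c ^ 4 * r₁ b c ^ 4 * r₁ b d ^ 4 :=
      calc r₁ a b * r₁ a c * r₁ a d * r₁ b c * r₁ b d * r₁ c d = (r₁ a c * r₁ b c * r₁ b d) * (r₁ a b * r₁ a d * r₁ c d) := by ring
        _ ≤ (r₁ a c * r₁ b c * r₁ b d) * ((r₁ a c * r₁ b c) * (r₁ a c * (r₁ b c * r₁ b d)) * (r₁ b c * r₁ b d)) :=
            mul_le_mul_of_nonneg_left (mul_le_mul (mul_le_mul (hm01 a c b) ((hm00 a c d).trans (mul_le_mul_of_nonneg_left (hm10 c b d) (h0 _ _)))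
        (h0 _ _) (mul_nonneg (h0 _ _) (h0 _ _))) (hm10 c b d) (h0 _ _) (mul_nonneg (mul_nonneg (h0 _ _) (h0 _ _)) (mul_nonneg (h0 _ _)
        (mul_nonneg (h0 _ _) (h0 _ _))))) (mul_nonneg (mul_nonneg (h0 _ _) (h0 _ _)) (h0 _ _))
        _ = r₁ a c ^ 3 * r₁ b c ^ 4 * r₁ b d ^ 3 := by ring
        _ ≤ r₁ a c ^ 4 * r₁ b c ^ 4 * r₁ b d ^ 4 := pow_mono3 (h1 _ _) (h1 _ _) (h1 _ _) (by norm_num) (by norm_num) (by norm_num)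
    exact hR.trans (mul_le_mul (mul_le_mul (h4 _ _) (h4 _ _) (pow_nonneg (h0 _ _) 4) (h0' _ _)) (h4 _ _) (pow_nonneg (h0 _ _) 4) (mul_nonneg (h0'
        _ _) (h0' _ _)))
  have t7 : ((r a c ^ 2)⁻¹ * (r b d ^ 2)⁻¹ * (r c d ^ 2)⁻¹) ≤ ((r₁ a b)⁻¹ * (r₁ a c)⁻¹ * (r₁ a d)⁻¹ * (r₁ b c)⁻¹ * (r₁ b d)⁻¹ * (r₁ c d)⁻¹) ^ 2
        := by
    refine monomial_le hP ?_ hQ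
    have hR : r₁ a b * r₁ a c * r₁ a d * r₁ b c * r₁ b d * r₁ c d ≤ r₁ a c ^ 4 * r₁ b d ^ 4 * r₁ c d ^ 4 :=
      calc r₁ a b * r₁ a c * r₁ a d * r₁ b c * r₁ b d * r₁ c d = (r₁ a c * r₁ b d * r₁ c d) * (r₁ a b * r₁ a d * r₁ b c) := by ring
        _ ≤ (r₁ a c * r₁ b d * r₁ c d) * ((r₁ a c * (r₁ b d * r₁ c d)) * (r₁ a c * r₁ c d) * (r₁ b d * r₁ c d)) :=
            mul_le_mul_of_nonneg_left (mul_le_mul (mul_le_mul ((hm01 a c b).trans (mul_le_mul_of_nonneg_left (hm01 b d c) (h0 _ _))) (hm00 a c d)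
        (h0 _ _) (mul_nonneg (h0 _ _) (mul_nonneg (h0 _ _) (h0 _ _)))) (hm01 b d c) (h0 _ _) (mul_nonneg (mul_nonneg (h0 _ _) (mul_nonneg (h0 _
        _) (h0 _ _))) (mul_nonneg (h0 _ _) (h0 _ _)))) (mul_nonneg (mul_nonneg (h0 _ _) (h0 _ _)) (h0 _ _))
        _ = r₁ a c ^ 3 * r₁ b d ^ 3 * r₁ c d ^ 4 := by ring
        _ ≤ r₁ a c ^ 4 * r₁ b d ^ 4 * r₁ c d ^ 4 := pow_mono3 (h1 _ _) (h1 _ _) (h1 _ _) (by norm_num) (by norm_num) (by norm_num)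
    exact hR.trans (mul_le_mul (mul_le_mul (h4 _ _) (h4 _ _) (pow_nonneg (h0 _ _) 4) (h0' _ _)) (h4 _ _) (pow_nonneg (h0 _ _) 4) (mul_nonneg (h0'
        _ _) (h0' _ _)))
  have t8 : ((r a d ^ 2)⁻¹ * (r b c ^ 2)⁻¹ * (r b d ^ 2)⁻¹) ≤ ((r₁ a b)⁻¹ * (r₁ a c)⁻¹ * (r₁ a d)⁻¹ * (r₁ b c)⁻¹ * (r₁ b d)⁻¹ * (r₁ c d)⁻¹) ^ 2
        := by
    refine monomial_le hP ?_ hQ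
    have hR : r₁ a b * r₁ a c * r₁ a d * r₁ b c * r₁ b d * r₁ c d ≤ r₁ a d ^ 4 * r₁ b c ^ 4 * r₁ b d ^ 4 :=
      calc r₁ a b * r₁ a c * r₁ a d * r₁ b c * r₁ b d * r₁ c d = (r₁ a d * r₁ b c * r₁ b d) * (r₁ a b * r₁ a c * r₁ c d) := by ring
        _ ≤ (r₁ a d * r₁ b c * r₁ b d) * ((r₁ a d * r₁ b d) * (r₁ a d * (r₁ b c * r₁ b d)) * (r₁ b c * r₁ b d)) :=
            mul_le_mul_of_nonneg_left (mul_le_mul (mul_le_mul (hm01 a d b) ((hm01 a d c).trans (mul_le_mul_of_nonneg_left (hm10 c b d) (h0 _ _)))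
        (h0 _ _) (mul_nonneg (h0 _ _) (h0 _ _))) (hm10 c b d) (h0 _ _) (mul_nonneg (mul_nonneg (h0 _ _) (h0 _ _)) (mul_nonneg (h0 _ _)
        (mul_nonneg (h0 _ _) (h0 _ _))))) (mul_nonneg (mul_nonneg (h0 _ _) (h0 _ _)) (h0 _ _))
        _ = r₁ a d ^ 3 * r₁ b c ^ 3 * r₁ b d ^ 4 := by ring
        _ ≤ r₁ a d ^ 4 * r₁ b c ^ 4 * r₁ b d ^ 4 := pow_mono3 (h1 _ _) (h1 _ _) (h1 _ _) (by norm_num) (by norm_num) (by norm_num)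
    exact hR.trans (mul_le_mul (mul_le_mul (h4 _ _) (h4 _ _) (pow_nonneg (h0 _ _) 4) (h0' _ _)) (h4 _ _) (pow_nonneg (h0 _ _) 4) (mul_nonneg (h0'
        _ _) (h0' _ _)))
  have t9 : ((r a d ^ 2)⁻¹ * (r b c ^ 2)⁻¹ * (r c d ^ 2)⁻¹) ≤ ((r₁ a b)⁻¹ * (r₁ a c)⁻¹ * (r₁ a d)⁻¹ * (r₁ b c)⁻¹ * (r₁ b d)⁻¹ * (r₁ c d)⁻¹) ^ 2
        := by
    refine monomial_le hP ?_ hQ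
    have hR : r₁ a b * r₁ a c * r₁ a d * r₁ b c * r₁ b d * r₁ c d ≤ r₁ a d ^ 4 * r₁ b c ^ 4 * r₁ c d ^ 4 :=
      calc r₁ a b * r₁ a c * r₁ a d * r₁ b c * r₁ b d * r₁ c d = (r₁ a d * r₁ b c * r₁ c d) * (r₁ a b * r₁ a c * r₁ b d) := by ring
        _ ≤ (r₁ a d * r₁ b c * r₁ c d) * ((r₁ a d * (r₁ b c * r₁ c d)) * (r₁ a d * r₁ c d) * (r₁ b c * r₁ c d)) :=
            mul_le_mul_of_nonneg_left (mul_le_mul (mul_le_mul ((hm01 a d b).trans (mul_le_mul_of_nonneg_left (hm00 b c d) (h0 _ _))) (hm01 a d c)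
        (h0 _ _) (mul_nonneg (h0 _ _) (mul_nonneg (h0 _ _) (h0 _ _)))) (hm00 b c d) (h0 _ _) (mul_nonneg (mul_nonneg (h0 _ _) (mul_nonneg (h0 _
        _) (h0 _ _))) (mul_nonneg (h0 _ _) (h0 _ _)))) (mul_nonneg (mul_nonneg (h0 _ _) (h0 _ _)) (h0 _ _))
        _ = r₁ a d ^ 3 * r₁ b c ^ 3 * r₁ c d ^ 4 := by ring
        _ ≤ r₁ a d ^ 4 * r₁ b c ^ 4 * r₁ c d ^ 4 := pow_mono3 (h1 _ _) (h1 _ _) (h1 _ _) (by norm_num) (by norm_num) (by norm_num)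
    exact hR.trans (mul_le_mul (mul_le_mul (h4 _ _) (h4 _ _) (pow_nonneg (h0 _ _) 4) (h0' _ _)) (h4 _ _) (pow_nonneg (h0 _ _) 4) (mul_nonneg (h0'
        _ _) (h0' _ _)))
  have t10 : ((r a b ^ 2)⁻¹ * (r a c ^ 2)⁻¹ * (r c d ^ 2)⁻¹) ≤ ((r₁ a b)⁻¹ * (r₁ a c)⁻¹ * (r₁ a d)⁻¹ * (r₁ b c)⁻¹ * (r₁ b d)⁻¹ * (r₁ c d)⁻¹) ^ 2
        := by
    refine monomial_le hP ?_ hQ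
    have hR : r₁ a b * r₁ a c * r₁ a d * r₁ b c * r₁ b d * r₁ c d ≤ r₁ a b ^ 4 * r₁ a c ^ 4 * r₁ c d ^ 4 :=
      calc r₁ a b * r₁ a c * r₁ a d * r₁ b c * r₁ b d * r₁ c d = (r₁ a b * r₁ a c * r₁ c d) * (r₁ a d * r₁ b c * r₁ b d) := by ring
        _ ≤ (r₁ a b * r₁ a c * r₁ c d) * ((r₁ a c * r₁ c d) * (r₁ a b * r₁ a c) * (r₁ a b * (r₁ a c * r₁ c d))) :=
            mul_le_mul_of_nonneg_left (mul_le_mul (mul_le_mul (hm00 a c d) (hm10 b a c) (h0 _ _) (mul_nonneg (h0 _ _) (h0 _ _))) ((hm10 b a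
        d).trans (mul_le_mul_of_nonneg_left (hm00 a c d) (h0 _ _))) (h0 _ _) (mul_nonneg (mul_nonneg (h0 _ _) (h0 _ _)) (mul_nonneg (h0 _ _) (h0
        _ _)))) (mul_nonneg (mul_nonneg (h0 _ _) (h0 _ _)) (h0 _ _))
        _ = r₁ a b ^ 3 * r₁ a c ^ 4 * r₁ c d ^ 3 := by ring
        _ ≤ r₁ a b ^ 4 * r₁ a c ^ 4 * r₁ c d ^ 4 := pow_mono3 (h1 _ _) (h1 _ _) (h1 _ _) (by norm_num) (by norm_num) (by norm_num)
    exact hR.trans (mul_le_mul (mul_le_mul (h4 _ _) (h4 _ _) (pow_nonneg (h0 _ _) 4) (h0' _ _)) (h4 _ _) (pow_nonneg (h0 _ _) 4) (mul_nonneg (h0'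
        _ _) (h0' _ _)))
  have t11 : ((r a b ^ 2)⁻¹ * (r a d ^ 2)⁻¹ * (r c d ^ 2)⁻¹) ≤ ((r₁ a b)⁻¹ * (r₁ a c)⁻¹ * (r₁ a d)⁻¹ * (r₁ b c)⁻¹ * (r₁ b d)⁻¹ * (r₁ c d)⁻¹) ^ 2
        := by
    refine monomial_le hP ?_ hQ
    have hR : r₁ a b * r₁ a c * r₁ a d * r₁ b c * r₁ b d * r₁ c d ≤ r₁ a b ^ 4 * r₁ a d ^ 4 * r₁ c d ^ 4 :=
      calc r₁ a b * r₁ a c * r₁ a d * r₁ b c * r₁ b d * r₁ c d = (r₁ a b * r₁ a d * r₁ c d) * (r₁ a c * r₁ b c * r₁ b d) := by ring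
        _ ≤ (r₁ a b * r₁ a d * r₁ c d) * ((r₁ a d * r₁ c d) * (r₁ a b * (r₁ a d * r₁ c d)) * (r₁ a b * r₁ a d)) :=
            mul_le_mul_of_nonneg_left (mul_le_mul (mul_le_mul (hm01 a d c) ((hm10 b a c).trans (mul_le_mul_of_nonneg_left (hm01 a d c) (h0 _ _)))
        (h0 _ _) (mul_nonneg (h0 _ _) (h0 _ _))) (hm10 b a d) (h0 _ _) (mul_nonneg (mul_nonneg (h0 _ _) (h0 _ _)) (mul_nonneg (h0 _ _)
        (mul_nonneg (h0 _ _) (h0 _ _))))) (mul_nonneg (mul_nonneg (h0 _ _) (h0 _ _)) (h0 _ _))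
        _ = r₁ a b ^ 3 * r₁ a d ^ 4 * r₁ c d ^ 3 := by ring
        _ ≤ r₁ a b ^ 4 * r₁ a d ^ 4 * r₁ c d ^ 4 := pow_mono3 (h1 _ _) (h1 _ _) (h1 _ _) (by norm_num) (by norm_num) (by norm_num)
    exact hR.trans (mul_le_mul (mul_le_mul (h4 _ _) (h4 _ _) (pow_nonneg (h0 _ _) 4) (h0' _ _)) (h4 _ _) (pow_nonneg (h0 _ _) 4) (mul_nonneg (h0'
        _ _) (h0' _ _)))
  have t12 : ((r a b ^ 2)⁻¹ * (r a c ^ 2)⁻¹ * (r b d ^ 2)⁻¹) ≤ ((r₁ a b)⁻¹ * (r₁ a c)⁻¹ * (r₁ a d)⁻¹ * (r₁ b c)⁻¹ * (r₁ b d)⁻¹ * (r₁ c d)⁻¹) ^ 2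
        := by
    refine monomial_le hP ?_ hQ
    have hR : r₁ a b * r₁ a c * r₁ a d * r₁ b c * r₁ b d * r₁ c d ≤ r₁ a b ^ 4 * r₁ a c ^ 4 * r₁ b d ^ 4 :=
      calc r₁ a b * r₁ a c * r₁ a d * r₁ b c * r₁ b d * r₁ c d = (r₁ a b * r₁ a c * r₁ b d) * (r₁ a d * r₁ b c * r₁ c d) := by ring
        _ ≤ (r₁ a b * r₁ a c * r₁ b d) * ((r₁ a b * r₁ b d) * (r₁ a b * r₁ a c) * (r₁ a c * (r₁ a b * r₁ b d))) :=
            mul_le_mul_of_nonneg_left (mul_le_mul (mul_le_mul (hm00 a b d) (hm10 b a c) (h0 _ _) (mul_nonneg (h0 _ _) (h0 _ _))) ((hm10 c a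
        d).trans (mul_le_mul_of_nonneg_left (hm00 a b d) (h0 _ _))) (h0 _ _) (mul_nonneg (mul_nonneg (h0 _ _) (h0 _ _)) (mul_nonneg (h0 _ _) (h0
        _ _)))) (mul_nonneg (mul_nonneg (h0 _ _) (h0 _ _)) (h0 _ _))
        _ = r₁ a b ^ 4 * r₁ a c ^ 3 * r₁ b d ^ 3 := by ring
        _ ≤ r₁ a b ^ 4 * r₁ a c ^ 4 * r₁ b d ^ 4 := pow_mono3 (h1 _ _) (h1 _ _) (h1 _ _) (by norm_num) (by norm_num) (by norm_num)
    exact hR.trans (mul_le_mul (mul_le_mul (h4 _ _) (h4 _ _) (pow_nonneg (h0 _ _) 4) (h0' _ _)) (h4 _ _) (pow_nonneg (h0 _ _) 4) (mul_nonneg (h0'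
        _ _) (h0' _ _)))
  have t13 : ((r a c ^ 2)⁻¹ * (r a d ^ 2)⁻¹ * (r b d ^ 2)⁻¹) ≤ ((r₁ a b)⁻¹ * (r₁ a c)⁻¹ * (r₁ a d)⁻¹ * (r₁ b c)⁻¹ * (r₁ b d)⁻¹ * (r₁ c d)⁻¹) ^ 2
        := by
    refine monomial_le hP ?_ hQ
    have hR : r₁ a b * r₁ a c * r₁ a d * r₁ b c * r₁ b d * r₁ c d ≤ r₁ a c ^ 4 * r₁ a d ^ 4 * r₁ b d ^ 4 :=
      calc r₁ a b * r₁ a c * r₁ a d * r₁ b c * r₁ b d * r₁ c d = (r₁ a c * r₁ a d * r₁ b d) * (r₁ a b * r₁ b c * r₁ c d) := by ring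
        _ ≤ (r₁ a c * r₁ a d * r₁ b d) * ((r₁ a d * r₁ b d) * (r₁ b d * (r₁ a c * r₁ a d)) * (r₁ a c * r₁ a d)) :=
            mul_le_mul_of_nonneg_left (mul_le_mul (mul_le_mul (hm01 a d b) ((hm01 b d c).trans (mul_le_mul_of_nonneg_left (hm10 c a d) (h0 _ _)))
        (h0 _ _) (mul_nonneg (h0 _ _) (h0 _ _))) (hm10 c a d) (h0 _ _) (mul_nonneg (mul_nonneg (h0 _ _) (h0 _ _)) (mul_nonneg (h0 _ _)
        (mul_nonneg (h0 _ _) (h0 _ _))))) (mul_nonneg (mul_nonneg (h0 _ _) (h0 _ _)) (h0 _ _))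
        _ = r₁ a c ^ 3 * r₁ a d ^ 4 * r₁ b d ^ 3 := by ring
        _ ≤ r₁ a c ^ 4 * r₁ a d ^ 4 * r₁ b d ^ 4 := pow_mono3 (h1 _ _) (h1 _ _) (h1 _ _) (by norm_num) (by norm_num) (by norm_num)
    exact hR.trans (mul_le_mul (mul_le_mul (h4 _ _) (h4 _ _) (pow_nonneg (h0 _ _) 4) (h0' _ _)) (h4 _ _) (pow_nonneg (h0 _ _) 4) (mul_nonneg (h0'
        _ _) (h0' _ _)))
  have t14 : ((r a b ^ 2)⁻¹ * (r a d ^ 2)⁻¹ * (r b c ^ 2)⁻¹) ≤ ((r₁ a b)⁻¹ * (r₁ a c)⁻¹ * (r₁ a d)⁻¹ * (r₁ b c)⁻¹ * (r₁ b d)⁻¹ * (r₁ c d)⁻¹) ^ 2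
        := by
    refine monomial_le hP ?_ hQ
    have hR : r₁ a b * r₁ a c * r₁ a d * r₁ b c * r₁ b d * r₁ c d ≤ r₁ a b ^ 4 * r₁ a d ^ 4 * r₁ b c ^ 4 :=
      calc r₁ a b * r₁ a c * r₁ a d * r₁ b c * r₁ b d * r₁ c d = (r₁ a b * r₁ a d * r₁ b c) * (r₁ a c * r₁ b d * r₁ c d) := by ring
        _ ≤ (r₁ a b * r₁ a d * r₁ b c) * ((r₁ a b * r₁ b c) * (r₁ a b * r₁ a d) * (r₁ b c * (r₁ a b * r₁ a d))) :=
            mul_le_mul_of_nonneg_left (mul_le_mul (mul_le_mul (hm00 a b c) (hm10 b a d) (h0 _ _) (mul_nonneg (h0 _ _) (h0 _ _))) ((hm10 c b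
        d).trans (mul_le_mul_of_nonneg_left (hm10 b a d) (h0 _ _))) (h0 _ _) (mul_nonneg (mul_nonneg (h0 _ _) (h0 _ _)) (mul_nonneg (h0 _ _) (h0
        _ _)))) (mul_nonneg (mul_nonneg (h0 _ _) (h0 _ _)) (h0 _ _))
        _ = r₁ a b ^ 4 * r₁ a d ^ 3 * r₁ b c ^ 3 := by ring
        _ ≤ r₁ a b ^ 4 * r₁ a d ^ 4 * r₁ b c ^ 4 := pow_mono3 (h1 _ _) (h1 _ _) (h1 _ _) (by norm_num) (by norm_num) (by norm_num)
    exact hR.trans (mul_le_mul (mul_le_mul (h4 _ _) (h4 _ _) (pow_nonneg (h0 _ _) 4) (h0' _ _)) (h4 _ _) (pow_nonneg (h0 _ _) 4) (mul_nonneg (h0'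
        _ _) (h0' _ _)))
  have t15 : ((r a c ^ 2)⁻¹ * (r a d ^ 2)⁻¹ * (r b c ^ 2)⁻¹) ≤ ((r₁ a b)⁻¹ * (r₁ a c)⁻¹ * (r₁ a d)⁻¹ * (r₁ b c)⁻¹ * (r₁ b d)⁻¹ * (r₁ c d)⁻¹) ^ 2
        := by
    refine monomial_le hP ?_ hQ
    have hR : r₁ a b * r₁ a c * r₁ a d * r₁ b c * r₁ b d * r₁ c d ≤ r₁ a c ^ 4 * r₁ a d ^ 4 * r₁ b c ^ 4 :=
      calc r₁ a b * r₁ a c * r₁ a d * r₁ b c * r₁ b d * r₁ c d = (r₁ a c * r₁ a d * r₁ b c) * (r₁ a b * r₁ b d * r₁ c d) := by ring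
        _ ≤ (r₁ a c * r₁ a d * r₁ b c) * ((r₁ a c * r₁ b c) * (r₁ b c * (r₁ a c * r₁ a d)) * (r₁ a c * r₁ a d)) :=
            mul_le_mul_of_nonneg_left (mul_le_mul (mul_le_mul (hm01 a c b) ((hm00 b c d).trans (mul_le_mul_of_nonneg_left (hm10 c a d) (h0 _ _)))
        (h0 _ _) (mul_nonneg (h0 _ _) (h0 _ _))) (hm10 c a d) (h0 _ _) (mul_nonneg (mul_nonneg (h0 _ _) (h0 _ _)) (mul_nonneg (h0 _ _)
        (mul_nonneg (h0 _ _) (h0 _ _))))) (mul_nonneg (mul_nonneg (h0 _ _) (h0 _ _)) (h0 _ _))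
        _ = r₁ a c ^ 4 * r₁ a d ^ 3 * r₁ b c ^ 3 := by ring
        _ ≤ r₁ a c ^ 4 * r₁ a d ^ 4 * r₁ b c ^ 4 := pow_mono3 (h1 _ _) (h1 _ _) (h1 _ _) (by norm_num) (by norm_num) (by norm_num)
    exact hR.trans (mul_le_mul (mul_le_mul (h4 _ _) (h4 _ _) (pow_nonneg (h0 _ _) 4) (h0' _ _)) (h4 _ _) (pow_nonneg (h0 _ _) 4) (mul_nonneg (h0'
        _ _) (h0' _ _)))
  linarith [t0, t1, t2, t3, t4, t5, t6, t7, t8, t9, t10, t11, t12, t13, t14, t15]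

/-- **The interpolated form**: for `K ≥ 0`, `√(K·T16) ≤ √(16K)·Π_{pairs} r₁⁻¹`. [folklore] -/
theorem sqrt_mul_tree16_le (hr1 : ∀ x y, 1 ≤ r x y) (h1 : ∀ x y, 1 ≤ r₁ x y) (hsymm : ∀ x y, r₁ x y = r₁ y x)
    (hmul : ∀ x y z, r₁ x z ≤ r₁ x y * r₁ y z) (h4 : ∀ x y, r₁ x y ^ 4 ≤ r x y) {K : ℝ} (hK : 0 ≤ K) (a b c d : ι) :
    Real.sqrt (K * ((r a b ^ 2)⁻¹ * (r a c ^ 2)⁻¹ * (r a d ^ 2)⁻¹ + (r a b ^ 2)⁻¹ * (r b c ^ 2)⁻¹ * (r b d ^ 2)⁻¹ + (r a c ^ 2)⁻¹ * (r b c ^ 2)⁻¹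
        * (r c d ^ 2)⁻¹ + (r a d ^ 2)⁻¹ * (r b d ^ 2)⁻¹ * (r c d ^ 2)⁻¹ + (r a b ^ 2)⁻¹ * (r b c ^ 2)⁻¹ * (r c d ^ 2)⁻¹ + (r a b ^ 2)⁻¹ * (r b d
        ^ 2)⁻¹ * (r c d ^ 2)⁻¹ + (r a c ^ 2)⁻¹ * (r b c ^ 2)⁻¹ * (r b d ^ 2)⁻¹ + (r a c ^ 2)⁻¹ * (r b d ^ 2)⁻¹ * (r c d ^ 2)⁻¹ + (r a d ^ 2)⁻¹ *
        (r b c ^ 2)⁻¹ * (r b d ^ 2)⁻¹ + (r a d ^ 2)⁻¹ * (r b c ^ 2)⁻¹ * (r c d ^ 2)⁻¹ + (r a b ^ 2)⁻¹ * (r a c ^ 2)⁻¹ * (r c d ^ 2)⁻¹ + (r a b ^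
        2)⁻¹ * (r a d ^ 2)⁻¹ * (r c d ^ 2)⁻¹ + (r a b ^ 2)⁻¹ * (r a c ^ 2)⁻¹ * (r b d ^ 2)⁻¹ + (r a c ^ 2)⁻¹ * (r a d ^ 2)⁻¹ * (r b d ^ 2)⁻¹ + (r
        a b ^ 2)⁻¹ * (r a d ^ 2)⁻¹ * (r b c ^ 2)⁻¹ + (r a c ^ 2)⁻¹ * (r a d ^ 2)⁻¹ * (r b c ^ 2)⁻¹)) ≤
      Real.sqrt (16 * K) * ((r₁ a b)⁻¹ * (r₁ a c)⁻¹ * (r₁ a d)⁻¹ * (r₁ b c)⁻¹ * (r₁ b d)⁻¹ * (r₁ c d)⁻¹) := by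
  have h0 : ∀ a b, 0 ≤ r₁ a b := fun a b => zero_le_one.trans (h1 a b)
  have hi : ∀ a b, 0 ≤ (r₁ a b)⁻¹ := fun a b => inv_nonneg.2 (h0 a b)
  have hQ0 : 0 ≤ (r₁ a b)⁻¹ * (r₁ a c)⁻¹ * (r₁ a d)⁻¹ * (r₁ b c)⁻¹ * (r₁ b d)⁻¹ * (r₁ c d)⁻¹ := mul_nonneg (mul_nonneg (mul_nonneg (mul_nonneg
        (mul_nonneg (hi _ _) (hi _ _)) (hi _ _)) (hi _ _)) (hi _ _)) (hi _ _)
  have h := tree16_le_fullgraph hr1 h1 hsymm hmul h4 a b c d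
  calc _ ≤ Real.sqrt (K * (16 * ((r₁ a b)⁻¹ * (r₁ a c)⁻¹ * (r₁ a d)⁻¹ * (r₁ b c)⁻¹ * (r₁ b d)⁻¹ * (r₁ c d)⁻¹) ^ 2)) := Real.sqrt_le_sqrt
        (mul_le_mul_of_nonneg_left h hK)
    _ = Real.sqrt (16 * K) * ((r₁ a b)⁻¹ * (r₁ a c)⁻¹ * (r₁ a d)⁻¹ * (r₁ b c)⁻¹ * (r₁ b d)⁻¹ * (r₁ c d)⁻¹) := by
        rw [show K * (16 * ((r₁ a b)⁻¹ * (r₁ a c)⁻¹ * (r₁ a d)⁻¹ * (r₁ b c)⁻¹ * (r₁ b d)⁻¹ * (r₁ c d)⁻¹) ^ 2) = (16 * K) * ((r₁ a b)⁻¹ * (r₁ a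
        c)⁻¹ * (r₁ a d)⁻¹ * (r₁ b c)⁻¹ * (r₁ b d)⁻¹ * (r₁ c d)⁻¹) ^ 2 by ring, Real.sqrt_mul (by positivity), Real.sqrt_sq hQ0]

/-! ## §3. Toy -/

/-- Toy (one tree on numbers): sites on a line at `0,1,2,3` with `r₁ = 2^d`, `r = 16^d`: the path tree `0–1–2–3` has
`r⁻²` product `16^{-6}` and the full-graph product is `2^{-(1+2+3+1+2+1)} = 2^{-10}`, `(2^{-10})² = 2^{-20} ≥ 16^{-6} = 2^{-24}`. -/
example : ((16 : ℝ) ^ 2)⁻¹ * ((16 : ℝ) ^ 2)⁻¹ * ((16 : ℝ) ^ 2)⁻¹ ≤ (((2 : ℝ) ^ 10)⁻¹) ^ 2 := by norm_num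

end Summit.QuantumFields.BalabanUV.T4Continuum.NE7b.SupTreeSixteenFullGraph
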